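import Mathlib
import HarnessLib

/-!
# (C3) mechanism, kernel lemma (H): a cocycle of the cyclic group `⟨F⟩ / ⟨F^f⟩` into `B / (F^f − 1)B`
# is a coboundary whenever `F^f − 1` is injective on `B`
# (cell `bsd-addord`, seat bsd-addord-w2-acc5 gen 0; crux `KatoKuriharaPortThreeShared` =
# stmt-BirchSwinnertonDyer-19560, residual input (C3) = THEOREM D's `hbad`; `--supports 19560`)

## Why (the place of this lemma in the removal of `hbad`)

THEOREM D (n1011's `Derivative.Rat.exists_isKolyvaginSystem_propagatedSelmerStructure`, via ★ PK-6₂)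
needs, at every BAD place `w ∤ 3r` of a Kato-stratum row, that Kolyvagin's derivative class `κ_r`
localises into `𝓕_can,w = im(H¹(ℚ_w, T₃E) → H¹(ℚ_w, E[3^{k+1}]))`; today this is supplied only on
the rows with `E(ℚ_w)[3] = 0` (`hbad`, where `H¹(ℚ_w, E[3^{k+1}]) = 0`) or on thinned data
(END-b, `3 ∤ ord(w mod q)`).  Write `D = G_{ℚ_w} ⊇ D₀ = D ∩ G_{ℚ(μ_r)}` (index `f`), `Δ = D/D₀ = ⟨F⟩`,
`I = I_w ≤ D₀`.  The obstruction to the local descent is a class `[y_w] ∈ H¹(Δ, H¹(D₀, T))`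
(the restriction of the global cocycle `g ↦ ((g − 1)·D_r c_r)/M`); its GROUP is non-zero exactly when
`3 ∣ f` and `w` is anomalous (cell memo W2C3-C3-LOCAL-ANALYSIS-g4), but the CLASS vanishes because
(U) the cocycle takes values in the universal norms of the cyclotomic `ℤ₃`-tower at `w`
(`IsEulerSystem.cores_p`), which are unramified at `T`-level: `UN ⊆ H¹_ur(D₀,T) = T^I/(F^f − 1)T^I`;
and (H) **`H¹(Δ, T^I/(F^f − 1)T^I) = 0`** since `F^f − 1` is injective on `T^I` (`T^{D₀} = 0`).
THIS FILE is (H) in its natural generality (pure algebra; no elliptic curve, no Galois group):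
for an `R`-module `B`, a linear endomorphism `F` and `f : ℕ` with `F^f − 1` injective, and
`N := Σ_{i<f} F^i` (the norm element of the cyclic group `⟨F⟩/⟨F^f⟩` acting on `B/(F^f − 1)B`):

* `normElement_mul_sub_one` / `sub_one_mul_normElement`: `N·(F − 1) = F^f − 1 = (F − 1)·N`;
* `injective_normElement_of_injective_pow_sub_one`: `N` is injective;
* **`mem_range_sub_one_of_normElement_mem_range_pow_sub_one`**: `N x ∈ im(F^f − 1) ⟹ x ∈ im(F − 1)`
  — every `1`-cocycle of `⟨F⟩/⟨F^f⟩` with values in `B/(F^f − 1)B` (a cocycle is its value `x̄` at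
  `F`, subject to `N x̄ = 0`) is a coboundary `(F − 1)ȳ`;
* `exists_eq_sub_one_add_pow_sub_one`: the same, unpacked (`x = (F − 1) y + (F^f − 1) y′`, indeed
  with `y′ = 0`);
* `injective_pow_sub_one_of_forall_fixed_eq_zero`: the hypothesis from "no non-zero fixed vector of
  `F^f`" (for `T^I` at a bad `w`: `(T^I)^{F^f} = T^{D₀} = 0`, no `3`-power torsion of `E` over the
  unramified extension `ℚ(μ_r)_w` is infinitely `3`-divisible).

HONEST LIMITS: a TOOL lemma; closes nothing; (U) and the descent lemma are separate files; nothing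
is booked.  References: K. Rubin, *Euler Systems* (2000), §4.6 (proof of Thm. 4.5.1; not held —
the mechanism is reconstructed in the seat memo HOME/acc5/ACC5-C3-MECHANISM-g0.md); B. Mazur,
K. Rubin, Mem. AMS 799 (2004), App. A, Prop. A.2; S. Lang, *Algebraic groups over finite fields*
(1956) (the shape `H¹(Ẑ-quotient, ·) = 0` for an isogeny `F^f − 1`).
-/

set_option linter.dupNamespace false

namespace Summit.BirchSwinnertonDyer.BirchSwinnertonDyer.Theorems.KimAtThreePortSharedC3

open Finset

variable {R : Type*} [CommRing R] {B : Type*} [AddCommGroup B] [Module R B]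

/-- The norm element `N = Σ_{i<f} F^i` of the cyclic group generated by `F` modulo `F^f`, as an
endomorphism of `B`. [folklore] -/
theorem normElement_mul_sub_one (F : Module.End R B) (f : ℕ) :
    (∑ i ∈ range f, F ^ i) * (F - 1) = F ^ f - 1 :=
  geom_sum_mul F f

/-- `(F − 1)·N = F^f − 1` (the other order; `F` commutes with its powers). [folklore] -/
theorem sub_one_mul_normElement (F : Module.End R B) (f : ℕ) :
    (F - 1) * (∑ i ∈ range f, F ^ i) = F ^ f - 1 :=
  mul_geom_sum F f

/-- If `F^f − 1` is injective on `B` then so is the norm element `N = Σ_{i<f} F^i`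
(`(F − 1) ∘ N = F^f − 1`). [folklore] -/
theorem injective_normElement_of_injective_pow_sub_one (F : Module.End R B) (f : ℕ)
    (hinj : Function.Injective (F ^ f - 1 : Module.End R B)) :
    Function.Injective (∑ i ∈ range f, F ^ i : Module.End R B) := by
  intro a b hab
  apply hinj
  have h := congrArg (F - 1 : Module.End R B) hab
  simpa only [← Module.End.mul_apply, sub_one_mul_normElement] using h

/-- **(H): every `1`-cocycle of `⟨F⟩/⟨F^f⟩` into `B/(F^f − 1)B` is a coboundary.**  If `F^f − 1` is
injective on `B` and `N x = Σ_{i<f} F^i x` lies in the image of `F^f − 1` (i.e. `N x̄ = 0` in the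
quotient `B/(F^f − 1)B` — the cocycle condition for the value `x̄` at the generator), then `x` lies
in the image of `F − 1` (i.e. `x̄ = (F − 1)ȳ` is a coboundary).  Proof: `N x = (F^f − 1) y = N (F − 1) y`
and `N` is injective.  Applied with `B = T^{I_w}`, `F` = Frobenius, `f` = the residue degree of `w`
in `ℚ(μ_r)`: `H¹(Gal(ℚ(μ_r)_w/ℚ_w), H¹_ur(ℚ(μ_r)_w, T₃E)) = 0`.
[cite: MazurRubin2004, App. A Prop. A.2 (the local condition of [Ru6] Thm. 4.5.1 at the primes of Σ)] -/
theorem mem_range_sub_one_of_normElement_mem_range_pow_sub_one (F : Module.End R B) (f : ℕ)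
    (hinj : Function.Injective (F ^ f - 1 : Module.End R B)) {x : B}
    (hx : (∑ i ∈ range f, F ^ i) x ∈ LinearMap.range (F ^ f - 1 : Module.End R B)) :
    x ∈ LinearMap.range (F - 1 : Module.End R B) := by
  obtain ⟨y, hy⟩ := hx
  refine ⟨y, injective_normElement_of_injective_pow_sub_one F f hinj ?_⟩
  rw [← hy, ← Module.End.mul_apply, normElement_mul_sub_one]

/-- (H) unpacked: under the same hypotheses `x = (F − 1) y` for some `y`. [folklore] -/
theorem exists_eq_sub_one_apply_of_normElement_mem_range (F : Module.End R B) (f : ℕ)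
    (hinj : Function.Injective (F ^ f - 1 : Module.End R B)) {x : B}
    (hx : ∃ y : B, (F ^ f - 1 : Module.End R B) y = (∑ i ∈ range f, F ^ i) x) :
    ∃ y : B, x = F y - y := by
  obtain ⟨y, hy⟩ := mem_range_sub_one_of_normElement_mem_range_pow_sub_one F f hinj
    (by obtain ⟨y, hy⟩ := hx; exact ⟨y, hy⟩)
  exact ⟨y, by rw [← hy, LinearMap.sub_apply, Module.End.one_apply]⟩

/-- (H) in quotient form: if `F^f − 1` is injective on `B`, every `x` whose norm `N x` vanishes in
`B ⧸ im(F^f − 1)` is congruent to an element of `im(F − 1)` — indeed lies in it. [folklore] -/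
theorem mkQ_mem_map_range_sub_one_of_normElement_eq_zero (F : Module.End R B) (f : ℕ)
    (hinj : Function.Injective (F ^ f - 1 : Module.End R B)) {x : B}
    (hx : (LinearMap.range (F ^ f - 1 : Module.End R B)).mkQ ((∑ i ∈ range f, F ^ i) x) = 0) :
    (LinearMap.range (F ^ f - 1 : Module.End R B)).mkQ x ∈
      (LinearMap.range (F - 1 : Module.End R B)).map (LinearMap.range (F ^ f - 1 : Module.End R B)).mkQ := by
  rw [Submodule.mkQ_apply, Submodule.Quotient.mk_eq_zero] at hx
  exact Submodule.mem_map_of_mem (mem_range_sub_one_of_normElement_mem_range_pow_sub_one F f hinj hx)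

/-- The injectivity hypothesis from "no non-zero fixed vector": if `F^f v = v ⟹ v = 0` then
`F^f − 1` is injective (for `B = T^{I_w}`: `(T^{I_w})^{F^f} = T^{D₀} = 0` because `E` has finite
`3`-power torsion over the unramified extension `ℚ(μ_r)_w`). [folklore] -/
theorem injective_pow_sub_one_of_forall_fixed_eq_zero (F : Module.End R B) (f : ℕ)
    (h0 : ∀ v : B, (F ^ f) v = v → v = 0) :
    Function.Injective (F ^ f - 1 : Module.End R B) := by
  rw [← LinearMap.ker_eq_bot, LinearMap.ker_eq_bot']
  intro v hv
  rw [LinearMap.sub_apply, Module.End.one_apply, sub_eq_zero] at hv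
  exact h0 v hv

/-- (H) with the fixed-vector hypothesis substituted: `(∀ v, F^f v = v → v = 0)` and
`N x ∈ im(F^f − 1)` give `x ∈ im(F − 1)`. [folklore] -/
theorem mem_range_sub_one_of_normElement_mem_range_of_forall_fixed_eq_zero (F : Module.End R B)
    (f : ℕ) (h0 : ∀ v : B, (F ^ f) v = v → v = 0) {x : B}
    (hx : (∑ i ∈ range f, F ^ i) x ∈ LinearMap.range (F ^ f - 1 : Module.End R B)) :
    x ∈ LinearMap.range (F - 1 : Module.End R B) :=
  mem_range_sub_one_of_normElement_mem_range_pow_sub_one F f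
    (injective_pow_sub_one_of_forall_fixed_eq_zero F f h0) hx

end Summit.BirchSwinnertonDyer.BirchSwinnertonDyer.Theorems.KimAtThreePortSharedC3
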